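import Summits.AtomisticToContinuum.BoseEinsteinCondensation.Theorems.SoloInformedCondensateNumberBound
import Summits.AtomisticToContinuum.BoseEinsteinCondensation.Theorems.SoloInformedResidueCriterion
import Literature.MathematicalPhysics.QuantumManyBody.GroundState
import Literature.MathematicalPhysics.QuantumManyBody.CondensateOccupationStability
import Literature.MathematicalPhysics.QuantumManyBody.BoseGasMergeOccupation
import Literature.Analysis.FunctionSpaces.TorusFourierCalculus

/-!
# `√⟨φ, γ_Ψ φ⟩` is a seminorm; `condensateNumber ≤ λ_max(γ_Ψ)` for every ground state

Conjunct `BoseEinsteinCondensation` of `AtomisticToContinuum` — statement audit, part 1 of the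
ground-state door (soloist report `paper/sharpest.md` §1, §7). The audited statement measures
condensation through
`condensateNumber v N L = sup_{δ>0} inf {λ_max(γ_Ψ) : Ψ a Dirichlet trial state, ⟨Ψ, H_N Ψ⟩ ≤ E₀ + δ}`,
a minimising-sequence surrogate for the largest eigenvalue of the one-particle density matrix of
the ground state [LSSY2005, §1.2 (1.17)–(1.19)]. This file supplies the analytic input relating the
surrogate to actual ground states (`IsGroundState`, normalised minimisers of the closed form,
`Literature/…/GroundState.lean`), with `L²` data only (a ground state is merely measurable):

* `SoloInformed.occupation_rpow_half_le_add` — **`√⟨φ, γ_· φ⟩ = √N ‖a(φ)·‖` is a seminorm** in the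
  Dirichlet setting: `⟨φ, γ_Φ φ⟩^{1/2} ≤ ⟨φ, γ_Ψ φ⟩^{1/2} + (N ∫|Φ-Ψ|²)^{1/2}` (slices of an `L²`
  function are a.e. `L²`, Cauchy–Schwarz, Minkowski; cf. the periodic
  `condensateOccupation_rpow_half_le_add`);
* `SoloInformed.maxOccupation_rpow_half_le_add` — the same for `λ_max`, i.e. `λ_max(γ_Ψ)^{1/2}` is
  `√N`-Lipschitz in `L²`; `SoloInformed.maxOccupation_const_mul_of_norm_eq_one` — phase invariance;
* `SoloInformed.condensateNumber_le_maxOccupation_of_isGroundState` — **for EVERY ground state `Ψ`,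
  `condensateNumber v N L ≤ λ_max(γ_Ψ)`**, with no nondegeneracy assumption: a recovery sequence of
  trial states `Φₘ → Ψ` in `L²` has energies frequently below `E₀ + δ` (the closed form of `Ψ` is
  `E₀`), so the `δ`-level infimum is at most `λ_max(γ_{Φₘ}) → λ_max(γ_Ψ)`;
* `SoloInformed.eventually_le_maxOccupation_of_hasGroundStateBEC` — hence, unconditionally, BEC in
  the audited sense forces `λ_max(γ_Ψ) ≥ cN` for every ground state `Ψ` of the large boxes
  `Λ_{(N/ρ)^{1/3}}` (in particular for degenerate ground spaces the audited quantity is at most the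
  infimum over ground states, as the statement's docstring asserts).

Part 2 (`SoloInformedGroundStateDoor.lean`) proves the converse inequality under nondegeneracy.

References: [LSSY2005] Lieb–Seiringer–Solovej–Yngvason, *The Mathematics of the Bose Gas and its
Condensation* (2005), §1.2 (1.17)–(1.19), App. A; [ReedSimonIV1978] Reed–Simon, *Methods of Modern
Mathematical Physics IV* (1978), §XIII.12; [Kato1966] Kato, *Perturbation Theory*, VI §1.3–1.4.
-/

noncomputable section

open MeasureTheory Filter Set
open scoped ENNReal NNReal ComplexConjugate Topology

namespace Summit.AtomisticToContinuum.BoseEinsteinCondensation.Theorems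

open Literature.MathematicalPhysics.QuantumManyBody.BoseGas

variable {n : ℕ}

/-! ### Bookkeeping -/

/-- The `N`-particle box is measurable. [folklore] -/
theorem SoloInformed.measurableSet_boxN (N : ℕ) (L : ℝ) : MeasurableSet (boxN N L) := by
  have hb : box L = ⋂ k : Fin 3, (fun x : Space => x k) ⁻¹' Set.Ioo 0 L := by
    ext x; simp [box]
  have hbm : MeasurableSet (box L) := by
    rw [hb]
    exact MeasurableSet.iInter fun k => measurableSet_Ioo.preimage (by fun_prop)
  have : boxN N L = ⋂ i : Fin N, (fun X : Config N => X i) ⁻¹' box L := by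
    ext X; simp [boxN]
  rw [this]
  exact MeasurableSet.iInter fun i => hbm.preimage (measurable_pi_apply i)

/-- The `N`-particle box is relabelling invariant. [folklore] -/
theorem SoloInformed.comp_perm_mem_boxN_iff {N : ℕ} (σ : Equiv.Perm (Fin N)) (L : ℝ)
    (Y : Config N) : Y ∘ σ ∈ boxN N L ↔ Y ∈ boxN N L := by
  simp only [boxN, Set.mem_setOf_eq, Function.comp_apply]
  exact ⟨fun h i => by simpa using h (σ.symm i), fun h i => h (σ i)⟩

/-- Relabelling the particles is measurable. [folklore] -/
theorem SoloInformed.measurable_comp_perm {N : ℕ} (σ : Equiv.Perm (Fin N)) :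
    Measurable fun X : Config N => X ∘ σ :=
  measurable_pi_lambda _ fun i => measurable_pi_apply (σ i)

/-- Relabelling the particles preserves Lebesgue measure on `(ℝ³)^N`. [folklore] -/
theorem SoloInformed.measurePreserving_comp_perm {N : ℕ} (σ : Equiv.Perm (Fin N)) :
    MeasurePreserving (fun X : Config N => X ∘ σ) volume volume := by
  have hmp := volume_measurePreserving_piCongrLeft (fun _ : Fin N => Space) σ.symm
  have h : ((MeasurableEquiv.piCongrLeft (fun _ : Fin N => Space) σ.symm) : Config N → Config N) =
      fun X => X ∘ σ := by
    funext X j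
    simp [MeasurableEquiv.piCongrLeft, Equiv.piCongrLeft_apply_eq_cast]
  rw [h] at hmp
  exact hmp

/-- Unfolding the occupation for `N = n + 1` particles. [cite: LSSY2005, §1.2 (1.17)] -/
theorem SoloInformed.occupation_succ (φ : Space → ℂ) (Ψ : Config (n + 1) → ℂ) :
    occupation (n + 1) φ Ψ = (n + 1 : ℝ≥0∞) *
      ∫⁻ Y : Config n, (‖∫ x, conj (φ x) * Ψ (Matrix.vecCons x Y)‖₊ : ℝ≥0∞) ^ 2 := by
  simp only [occupation]

/-- **Phase invariance of `λ_max`**: `λ_max(γ_{cΨ}) = λ_max(γ_Ψ)` for `|c| = 1`.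
[cite: LSSY2005, §1.2 (1.17)] -/
theorem SoloInformed.maxOccupation_const_mul_of_norm_eq_one {N : ℕ} {c : ℂ} (hc : ‖c‖ = 1)
    (Ψ : Config N → ℂ) : maxOccupation N (fun X => c * Ψ X) = maxOccupation N Ψ := by
  have h1 : ((‖c‖₊ : ℝ≥0∞) ^ 2) = 1 := by
    rw [coe_nnnorm_eq_one_of_norm_eq_one hc, one_pow]
  simp only [maxOccupation, occupation_const_mul, h1, one_mul]

/-! ### `L²` data: slices and integrability (measurability of `a(φ)Ψ` is
`SoloInformed.measurable_modePairing`) -/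

/-- Slices of a square-integrable `N`-body function are a.e. square integrable (Tonelli).
[folklore] -/
theorem SoloInformed.ae_lintegral_slice_ne_top {Ψ : Config (n + 1) → ℂ} (hΨ : Measurable Ψ)
    (hΨ2 : ∫⁻ X, (‖Ψ X‖₊ : ℝ≥0∞) ^ 2 ≠ ⊤) :
    ∀ᵐ Y : Config n, ∫⁻ x, (‖Ψ (Matrix.vecCons x Y)‖₊ : ℝ≥0∞) ^ 2 ≠ ⊤ := by
  have h := ae_lt_top (measurable_lintegral_sq_nnnorm_vecCons hΨ)
    (by rwa [lintegral_lintegral_sq_nnnorm_vecCons hΨ])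
  exact h.mono fun Y hY => hY.ne

/-- `conj φ · g` is integrable for square-integrable `φ`, `g` (Cauchy–Schwarz). [folklore] -/
theorem SoloInformed.integrable_conj_mul {φ g : Space → ℂ} (hφ : Measurable φ)
    (hφ2 : ∫⁻ x, (‖φ x‖₊ : ℝ≥0∞) ^ 2 ≠ ⊤) (hg : Measurable g)
    (hg2 : ∫⁻ x, (‖g x‖₊ : ℝ≥0∞) ^ 2 ≠ ⊤) :
    Integrable (fun x => conj (φ x) * g x) := by
  refine ⟨((Complex.continuous_conj.measurable.comp hφ).mul hg).aestronglyMeasurable, ?_⟩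
  have hcs := lintegral_mul_sq_le (volume : Measure Space)
    hφ.nnnorm.coe_nnreal_ennreal.aemeasurable hg.nnnorm.coe_nnreal_ennreal.aemeasurable
  have hlt : (∫⁻ x, (‖φ x‖₊ : ℝ≥0∞) * ‖g x‖₊) ^ 2 < ⊤ :=
    hcs.trans_lt (ENNReal.mul_lt_top hφ2.lt_top hg2.lt_top)
  have hne : ∫⁻ x, (‖φ x‖₊ : ℝ≥0∞) * ‖g x‖₊ ≠ ⊤ := by
    intro h
    rw [h, ENNReal.top_pow two_ne_zero] at hlt
    exact lt_irrefl _ hlt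
  have heq : (fun x => ‖conj (φ x) * g x‖ₑ) = fun x => (‖φ x‖₊ : ℝ≥0∞) * ‖g x‖₊ := by
    funext x
    rw [enorm_eq_nnnorm, nnnorm_mul, ENNReal.coe_mul, RCLike.nnnorm_conj]
  show ∫⁻ x, ‖conj (φ x) * g x‖ₑ < ⊤
  rw [heq]
  exact hne.lt_top

/-! ### `√⟨φ, γ_Ψ φ⟩` is a seminorm; `λ_max` is `L²`-continuous -/

/-- **`√⟨φ, γ_· φ⟩` is a seminorm** (Dirichlet setting, `L²` data): for measurable square-integrable
`Φ, Ψ : (ℝ³)^N → ℂ` and a normalised mode `φ`,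
`⟨φ, γ_Φ φ⟩^{1/2} ≤ ⟨φ, γ_Ψ φ⟩^{1/2} + (N ∫|Φ - Ψ|²)^{1/2}`
(`⟨φ, γ_Ψ φ⟩ = N‖a(φ)Ψ‖²`, `a(φ)` linear on a.e. slice, Minkowski, and
`N‖a(φ)(Φ-Ψ)‖² ≤ N‖Φ-Ψ‖²` by Cauchy–Schwarz). [cite: LSSY2005, App. A (A.11), (A.13)] -/
theorem SoloInformed.occupation_rpow_half_le_add {Φ Ψ : Config (n + 1) → ℂ} (hΦ : Measurable Φ)
    (hΨ : Measurable Ψ) (hΦ2 : ∫⁻ X, (‖Φ X‖₊ : ℝ≥0∞) ^ 2 ≠ ⊤)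
    (hΨ2 : ∫⁻ X, (‖Ψ X‖₊ : ℝ≥0∞) ^ 2 ≠ ⊤) {φ : Space → ℂ}
    (hφ : AEStronglyMeasurable φ volume) (hφ1 : ∫⁻ x, (‖φ x‖₊ : ℝ≥0∞) ^ 2 = 1) :
    occupation (n + 1) φ Φ ^ (1 / 2 : ℝ) ≤
      occupation (n + 1) φ Ψ ^ (1 / 2 : ℝ) +
        ((n + 1 : ℝ≥0∞) * ∫⁻ X, (‖Φ X - Ψ X‖₊ : ℝ≥0∞) ^ 2) ^ (1 / 2 : ℝ) := by
  -- WLOG the mode is (strongly) measurable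
  obtain ⟨φ', hφ'sm, hφφ'⟩ := hφ
  have hφ'm : Measurable φ' := hφ'sm.measurable
  have hφ'1 : ∫⁻ x, (‖φ' x‖₊ : ℝ≥0∞) ^ 2 = 1 := by
    rw [← hφ1]
    exact lintegral_congr_ae (hφφ'.mono fun x hx => by
      show ((‖φ' x‖₊ : ℝ≥0∞)) ^ 2 = (‖φ x‖₊ : ℝ≥0∞) ^ 2
      rw [hx])
  have hφ'2 : ∫⁻ x, (‖φ' x‖₊ : ℝ≥0∞) ^ 2 ≠ ⊤ := by rw [hφ'1]; exact ENNReal.one_ne_top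
  rw [occupation_congr_ae hφφ' Φ, occupation_congr_ae hφφ' Ψ]
  have hDm : Measurable fun X => Φ X - Ψ X := hΦ.sub hΨ
  -- a.e. additivity of the amplitude
  have hadd : ∀ᵐ Y : Config n,
      (∫ x, conj (φ' x) * Φ (Matrix.vecCons x Y)) =
        (∫ x, conj (φ' x) * Ψ (Matrix.vecCons x Y)) +
          ∫ x, conj (φ' x) * (Φ (Matrix.vecCons x Y) - Ψ (Matrix.vecCons x Y)) := by
    filter_upwards [SoloInformed.ae_lintegral_slice_ne_top hΦ hΦ2,
      SoloInformed.ae_lintegral_slice_ne_top hΨ hΨ2] with Y hYΦ hYΨ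
    have hiΦ := SoloInformed.integrable_conj_mul hφ'm hφ'2 (measurable_comp_vecCons_left hΦ Y) hYΦ
    have hiΨ := SoloInformed.integrable_conj_mul hφ'm hφ'2 (measurable_comp_vecCons_left hΨ Y) hYΨ
    have hiD : Integrable
        (fun x => conj (φ' x) * (Φ (Matrix.vecCons x Y) - Ψ (Matrix.vecCons x Y))) :=
      (hiΦ.sub hiΨ).congr (Eventually.of_forall fun x => by simp only [Pi.sub_apply]; ring)
    rw [← integral_add hiΨ hiD]
    congr 1
    funext x
    ring
  -- pointwise (a.e.) triangle inequality
  have htri : ∀ᵐ Y : Config n,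
      (‖∫ x, conj (φ' x) * Φ (Matrix.vecCons x Y)‖₊ : ℝ≥0∞) ≤
        (‖∫ x, conj (φ' x) * Ψ (Matrix.vecCons x Y)‖₊ : ℝ≥0∞) +
          (‖∫ x, conj (φ' x) * (Φ (Matrix.vecCons x Y) - Ψ (Matrix.vecCons x Y))‖₊ : ℝ≥0∞) :=
    hadd.mono fun Y hY => by
      rw [hY]
      exact_mod_cast nnnorm_add_le _ _
  -- Minkowski in `L²((ℝ³)^n)`
  have hmΨ : AEMeasurable
      (fun Y => (‖∫ x, conj (φ' x) * Ψ (Matrix.vecCons x Y)‖₊ : ℝ≥0∞)) volume :=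
    (SoloInformed.measurable_modePairing hφ'm hΨ).nnnorm.coe_nnreal_ennreal.aemeasurable
  have hmD : AEMeasurable (fun Y => (‖∫ x, conj (φ' x) *
      (Φ (Matrix.vecCons x Y) - Ψ (Matrix.vecCons x Y))‖₊ : ℝ≥0∞)) volume :=
    (SoloInformed.measurable_modePairing hφ'm hDm).nnnorm.coe_nnreal_ennreal.aemeasurable
  have hmink := ENNReal.lintegral_Lp_add_le hmΨ hmD (by norm_num : (1 : ℝ) ≤ 2)
  simp only [Pi.add_apply, ENNReal.rpow_two] at hmink
  -- `‖a(φ')(Φ - Ψ)‖² ≤ ‖Φ - Ψ‖²`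
  have hoccD : occupation (n + 1) φ' (fun X => Φ X - Ψ X) ≤
      (n + 1 : ℝ≥0∞) * ∫⁻ X, (‖Φ X - Ψ X‖₊ : ℝ≥0∞) ^ 2 :=
    (occupation_le_maxOccupation _ hφ'sm.aestronglyMeasurable hφ'1).trans
      (SoloInformed.maxOccupation_le hDm)
  have hhalf : (0 : ℝ) ≤ 1 / 2 := by norm_num
  calc occupation (n + 1) φ' Φ ^ (1 / 2 : ℝ)
      = ((n + 1 : ℝ≥0∞) *
          ∫⁻ Y, (‖∫ x, conj (φ' x) * Φ (Matrix.vecCons x Y)‖₊ : ℝ≥0∞) ^ 2) ^ (1 / 2 : ℝ) := by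
        rw [SoloInformed.occupation_succ]
    _ ≤ ((n + 1 : ℝ≥0∞) *
          ∫⁻ Y, ((‖∫ x, conj (φ' x) * Ψ (Matrix.vecCons x Y)‖₊ : ℝ≥0∞) +
            (‖∫ x, conj (φ' x) * (Φ (Matrix.vecCons x Y) - Ψ (Matrix.vecCons x Y))‖₊ : ℝ≥0∞))
              ^ 2) ^ (1 / 2 : ℝ) := by
        refine ENNReal.rpow_le_rpow ?_ hhalf
        refine mul_le_mul_right (lintegral_mono_ae (htri.mono fun Y hY => ?_)) _
        gcongr
    _ = (n + 1 : ℝ≥0∞) ^ (1 / 2 : ℝ) *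
          (∫⁻ Y, ((‖∫ x, conj (φ' x) * Ψ (Matrix.vecCons x Y)‖₊ : ℝ≥0∞) +
            (‖∫ x, conj (φ' x) * (Φ (Matrix.vecCons x Y) - Ψ (Matrix.vecCons x Y))‖₊ : ℝ≥0∞))
              ^ 2) ^ (1 / 2 : ℝ) :=
        ENNReal.mul_rpow_of_nonneg _ _ hhalf
    _ ≤ (n + 1 : ℝ≥0∞) ^ (1 / 2 : ℝ) *
          ((∫⁻ Y, (‖∫ x, conj (φ' x) * Ψ (Matrix.vecCons x Y)‖₊ : ℝ≥0∞) ^ 2) ^ (1 / 2 : ℝ) +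
            (∫⁻ Y, (‖∫ x, conj (φ' x) *
              (Φ (Matrix.vecCons x Y) - Ψ (Matrix.vecCons x Y))‖₊ : ℝ≥0∞) ^ 2) ^ (1 / 2 : ℝ)) :=
        mul_le_mul_right hmink _
    _ = ((n + 1 : ℝ≥0∞) *
          ∫⁻ Y, (‖∫ x, conj (φ' x) * Ψ (Matrix.vecCons x Y)‖₊ : ℝ≥0∞) ^ 2) ^ (1 / 2 : ℝ) +
        ((n + 1 : ℝ≥0∞) * ∫⁻ Y, (‖∫ x, conj (φ' x) *
          (Φ (Matrix.vecCons x Y) - Ψ (Matrix.vecCons x Y))‖₊ : ℝ≥0∞) ^ 2) ^ (1 / 2 : ℝ) := by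
        rw [mul_add, ENNReal.mul_rpow_of_nonneg _ _ hhalf, ENNReal.mul_rpow_of_nonneg _ _ hhalf]
    _ = occupation (n + 1) φ' Ψ ^ (1 / 2 : ℝ) +
        occupation (n + 1) φ' (fun X => Φ X - Ψ X) ^ (1 / 2 : ℝ) := by
        rw [SoloInformed.occupation_succ, SoloInformed.occupation_succ]
    _ ≤ occupation (n + 1) φ' Ψ ^ (1 / 2 : ℝ) +
        ((n + 1 : ℝ≥0∞) * ∫⁻ X, (‖Φ X - Ψ X‖₊ : ℝ≥0∞) ^ 2) ^ (1 / 2 : ℝ) :=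
        add_le_add le_rfl (ENNReal.rpow_le_rpow hoccD hhalf)

/-- **`λ_max` is `L²`-continuous (square-root form)**: for measurable square-integrable `Φ, Ψ`,
`λ_max(γ_Φ)^{1/2} ≤ λ_max(γ_Ψ)^{1/2} + (N ∫|Φ - Ψ|²)^{1/2}` (supremum of the seminorm bounds over
normalised modes). [cite: LSSY2005, §1.2 (1.17)–(1.18)] -/
theorem SoloInformed.maxOccupation_rpow_half_le_add {Φ Ψ : Config (n + 1) → ℂ}
    (hΦ : Measurable Φ) (hΨ : Measurable Ψ) (hΦ2 : ∫⁻ X, (‖Φ X‖₊ : ℝ≥0∞) ^ 2 ≠ ⊤)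
    (hΨ2 : ∫⁻ X, (‖Ψ X‖₊ : ℝ≥0∞) ^ 2 ≠ ⊤) :
    maxOccupation (n + 1) Φ ^ (1 / 2 : ℝ) ≤
      maxOccupation (n + 1) Ψ ^ (1 / 2 : ℝ) +
        ((n + 1 : ℝ≥0∞) * ∫⁻ X, (‖Φ X - Ψ X‖₊ : ℝ≥0∞) ^ 2) ^ (1 / 2 : ℝ) := by
  rw [one_div, ENNReal.rpow_inv_le_iff (by norm_num : (0 : ℝ) < 2)]
  show (⨆ (φ : Space → ℂ) (_ : AEStronglyMeasurable φ volume ∧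
      ∫⁻ x, (‖φ x‖₊ : ℝ≥0∞) ^ 2 = 1), occupation (n + 1) φ Φ) ≤ _
  refine iSup₂_le fun φ hφ => ?_
  have htwo : (0 : ℝ) ≤ 2 := by norm_num
  calc occupation (n + 1) φ Φ
      = (occupation (n + 1) φ Φ ^ (2⁻¹ : ℝ)) ^ (2 : ℝ) := by
        rw [← ENNReal.rpow_mul, inv_mul_cancel₀ (two_ne_zero : (2 : ℝ) ≠ 0), ENNReal.rpow_one]
    _ ≤ (occupation (n + 1) φ Ψ ^ (2⁻¹ : ℝ) +
          ((n + 1 : ℝ≥0∞) * ∫⁻ X, (‖Φ X - Ψ X‖₊ : ℝ≥0∞) ^ 2) ^ (2⁻¹ : ℝ)) ^ (2 : ℝ) := by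
        refine ENNReal.rpow_le_rpow ?_ htwo
        simpa only [one_div] using
          SoloInformed.occupation_rpow_half_le_add hΦ hΨ hΦ2 hΨ2 hφ.1 hφ.2
    _ ≤ (maxOccupation (n + 1) Ψ ^ (2⁻¹ : ℝ) +
          ((n + 1 : ℝ≥0∞) * ∫⁻ X, (‖Φ X - Ψ X‖₊ : ℝ≥0∞) ^ 2) ^ (2⁻¹ : ℝ)) ^ (2 : ℝ) :=
        ENNReal.rpow_le_rpow (add_le_add
          (ENNReal.rpow_le_rpow (occupation_le_maxOccupation Ψ hφ.1 hφ.2)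
            (by norm_num : (0 : ℝ) ≤ 2⁻¹)) le_rfl) htwo

/-! ### The condensate number and the ground state -/

/-- **`condensateNumber ≤ λ_max(γ_Ψ)` for every ground state `Ψ`** (no nondegeneracy needed): a
recovery sequence of trial states `Φₘ → Ψ` in `L²` has energies frequently below `E₀ + δ`
(`q̄[Ψ] = E₀`, definition of the closed form), so the `δ`-level infimum is at most
`λ_max(γ_{Φₘ}) → λ_max(γ_Ψ)` by `L²`-continuity. [cite: LSSY2005, §1.2 (1.17)–(1.19)] -/
theorem SoloInformed.condensateNumber_le_maxOccupation_of_isGroundState {v : ℝ → ℝ≥0∞} {L : ℝ}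
    {Ψ : Config (n + 1) → ℂ} (hΨ : IsGroundState v L Ψ) :
    condensateNumber v (n + 1) L ≤ maxOccupation (n + 1) Ψ := by
  have hE : groundStateEnergy v (n + 1) L ≠ ⊤ := hΨ.groundStateEnergy_ne_top
  have hΨ1 : ∫⁻ X, (‖Ψ X‖₊ : ℝ≥0∞) ^ 2 = 1 := hΨ.norm_eq
  unfold condensateNumber
  refine iSup₂_le fun δ hδ => ?_
  -- a recovery sequence with small energies
  have hlt : closedEnergy v L Ψ < groundStateEnergy v (n + 1) L + δ := by
    rw [hΨ.closedEnergy_eq]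
    exact ENNReal.lt_add_right hE hδ.ne'
  obtain ⟨Φ, hΦ⟩ := iInf_lt_iff.1 hlt
  obtain ⟨hT, hlim⟩ := iInf_lt_iff.1 hΦ
  have hfreq : ∃ᶠ m in atTop, energy v (Φ m) < groundStateEnergy v (n + 1) L + δ :=
    frequently_lt_of_liminf_lt (h := hlim)
  obtain ⟨κ, hκ, hκE⟩ := extraction_of_frequently_atTop hfreq
  have hd : Tendsto (fun m => ∫⁻ X, (‖(Φ (κ m)).ψ X - Ψ X‖₊ : ℝ≥0∞) ^ 2) atTop (𝓝 0) :=
    hT.comp hκ.tendsto_atTop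
  have hstep : ∀ m, (⨅ (Ψ' : TrialState (n + 1) L)
      (_ : energy v Ψ' ≤ groundStateEnergy v (n + 1) L + δ), maxOccupation (n + 1) Ψ'.ψ) ≤
      (maxOccupation (n + 1) Ψ ^ (1 / 2 : ℝ) +
        ((n + 1 : ℝ≥0∞) * ∫⁻ X, (‖(Φ (κ m)).ψ X - Ψ X‖₊ : ℝ≥0∞) ^ 2) ^ (1 / 2 : ℝ)) ^ 2 := by
    intro m
    refine (iInf_maxOccupation_le v (Φ (κ m)) (hκE m).le).trans ?_
    have h := SoloInformed.maxOccupation_rpow_half_le_add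
      (Φ (κ m)).contDiff.continuous.measurable hΨ.measurable
      (by rw [(Φ (κ m)).norm_eq]; exact ENNReal.one_ne_top)
      (by rw [hΨ1]; exact ENNReal.one_ne_top)
    calc maxOccupation (n + 1) (Φ (κ m)).ψ
        = (maxOccupation (n + 1) (Φ (κ m)).ψ ^ (1 / 2 : ℝ)) ^ 2 :=
          (ENNReal.rpow_half_sq _).symm
      _ ≤ _ := by gcongr
  -- the bounds converge to `λ_max(γ_Ψ)`
  have hN : (n + 1 : ℝ≥0∞) ≠ ⊤ := ENNReal.add_ne_top.2 ⟨ENNReal.natCast_ne_top n, ENNReal.one_ne_top⟩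
  have h1 : Tendsto (fun m => (n + 1 : ℝ≥0∞) * ∫⁻ X, (‖(Φ (κ m)).ψ X - Ψ X‖₊ : ℝ≥0∞) ^ 2)
      atTop (𝓝 0) := by
    have := ENNReal.Tendsto.const_mul hd (Or.inr hN)
    rwa [mul_zero] at this
  have h2 : Tendsto (fun m =>
      ((n + 1 : ℝ≥0∞) * ∫⁻ X, (‖(Φ (κ m)).ψ X - Ψ X‖₊ : ℝ≥0∞) ^ 2) ^ (1 / 2 : ℝ))
      atTop (𝓝 0) := by
    have := ((ENNReal.continuous_rpow_const (y := (1 / 2 : ℝ))).tendsto (0 : ℝ≥0∞)).comp h1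
    rwa [ENNReal.zero_rpow_of_pos (by norm_num : (0 : ℝ) < 1 / 2)] at this
  have h3 : Tendsto (fun m => maxOccupation (n + 1) Ψ ^ (1 / 2 : ℝ) +
      ((n + 1 : ℝ≥0∞) * ∫⁻ X, (‖(Φ (κ m)).ψ X - Ψ X‖₊ : ℝ≥0∞) ^ 2) ^ (1 / 2 : ℝ))
      atTop (𝓝 (maxOccupation (n + 1) Ψ ^ (1 / 2 : ℝ))) := by
    have := (tendsto_const_nhds (x := maxOccupation (n + 1) Ψ ^ (1 / 2 : ℝ))).add h2
    rwa [add_zero] at this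
  have h4 := ((ENNReal.continuous_pow 2).tendsto _).comp h3
  rw [ENNReal.rpow_half_sq] at h4
  exact ge_of_tendsto' h4 hstep

/-- **Necessity, unconditionally.** If `HasGroundStateBEC v ρ` (the audited sense), then with the
same constant `c`, for all large `N` EVERY ground state `Ψ` of `N` bosons in `Λ_{(N/ρ)^{1/3}}` has
`λ_max(γ_Ψ) ≥ c N` — no nondegeneracy needed. [cite: LSSY2005, §1.2 (1.17)–(1.19)] -/
theorem SoloInformed.eventually_le_maxOccupation_of_hasGroundStateBEC {v : ℝ → ℝ≥0∞} {ρ : ℝ}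
    (h : HasGroundStateBEC v ρ) :
    ∃ c : ℝ, 0 < c ∧ ∀ᶠ N : ℕ in atTop, ∀ Ψ : Config N → ℂ,
      IsGroundState v (sideLength ρ N) Ψ → ENNReal.ofReal (c * N) ≤ maxOccupation N Ψ := by
  obtain ⟨c, hc, hN⟩ := h
  refine ⟨c, hc, ?_⟩
  filter_upwards [hN, eventually_ge_atTop 1] with N hcN hN1 Ψ hΨ
  obtain ⟨m, rfl⟩ : ∃ m, N = m + 1 := ⟨N - 1, (Nat.sub_add_cancel hN1).symm⟩
  exact hcN.trans (SoloInformed.condensateNumber_le_maxOccupation_of_isGroundState hΨ)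

end Summit.AtomisticToContinuum.BoseEinsteinCondensation.Theorems

end
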